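import Summits.AtomisticToContinuum.Crystallization.Theorems.ChessboardParticlePlanesLjLaminarWindowsMinDistance

/-!
# Lennard-Jones ground states are `0.712`-separated; the ground-state-free CONTACT FLOOR (lens-5 generation 18, §18.5 — DEF-FREE, landable)

Route `LoopTunnelDial`, crux `PocketCase` (stmt-AtomisticToContinuum-27294), helper material of the CONTACT DIAL (preview v8.1,
`HOME/decomp-a2c-lens-5/g18/preview/line-pocket-contact-v81.lean`).  This file is DEFINITION-FREE and imports only the landed
`LjLaminarWindows` force/capacity engine; a prover may land it verbatim (`--supports stmt-AtomisticToContinuum-27294 --as helper`).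

CONTENT (all `[folklore]`, 0 sorry).  The tree's `stub_minDistance07` (`r_min ≥ 7/10` in every Lennard-Jones ground state) combines
(i) removal + insertion `∑_{k ≠ p} h(r_{pk}) ≥ 1` (ground states only), (ii) force balance dotted with the pair direction + Cauchy–Schwarz
(`h′(a) ≤ ∑_{k ≠ p,q} |h′(r_{pk})|`) and (iii) the CERTIFIED capacity `ForceCapacity` of the charged minus-energy `kF = h + |h′|/25`
(`c ∈ [171/500, 7/20]`).  Steps (ii)+(iii) are GROUND-STATE-FREE; run at the fixed admissible `c = 7/20` they give

* `contactFloor_le_siteEnergy` — **the contact floor**: at every particle `p` with ZERO NET FORCE of an injective `7/10`-separated finite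
  configuration, for every `q ≠ p` at distance `a`, `𝓔ᵖ ≥ −(1/12)·(3840/49 + h(a) − h′(a)/25)` (`h = hLJ = −12·V_LJ`, `h′ = hLJ'`);
* `siteEnergy_ge_of_contact_lt_0716` — RUNG: a force-balanced particle with a partner closer than `0.716` has site energy `≥ −7/10`
  (above the bulk energy per particle `e⋆ ≤ −0.711`), and `≥ −2/25 > −1/12` if the partner is closer than `0.712`;
* `lennardJones_groundState_dist_ge_0712` — **every Lennard-Jones ground state, of every size, has all interparticle distances
  `≥ 0.712 = 89/125`** (tree: `7/10`; print: `0.684`, Yuhjtman 2015), because a contact floor above `−1/12` contradicts the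
  removal/insertion bound `𝓔ᵖ ≤ −1/12` (`forceBalance_one_le_sum_hLJ`).
The two numerals are Bernstein-positive polynomial inequalities on `[7/10, ρ]`, proved by `nlinarith` exactly as the tree's `forceFinal_poly`.
-/

noncomputable section

open scoped BigOperators InnerProductSpace
open Literature.MathematicalPhysics.StatisticalMechanics
open Literature.MathematicalPhysics.StatisticalMechanics.Yuhjtman2015
open Summit.AtomisticToContinuum.Crystallization.Theorems.LjLaminarWindowsSketch

namespace Summit.AtomisticToContinuum.Crystallization.Theorems.LoopTunnelDialContactFloor

variable {N : ℕ}

/-- `𝓔ᵖ = −(1/12) ∑_{k ≠ p} h(r_{pk})` (Yuhjtman's normalisation, `lennardJones_eq_hLJ`). [folklore] -/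
theorem siteEnergy_eq_sum_hLJ (y : Fin N → EuclideanSpace ℝ (Fin 3)) (p : Fin N) :
    siteEnergy lennardJones y p = -(1 / 12) * ∑ k ∈ Finset.univ.erase p, hLJ (dist (y p) (y k)) := by
  simp only [siteEnergy, lennardJones_eq_hLJ, Finset.mul_sum]

/-- **GS-free force inequality** (step (ii) of the tree's `stub_forceBalance`, with `ForceBalancedAt` in place of `IsGroundState`):
at a force-balanced particle `p`, for every `q ≠ p` at distance `a`, `h′(a) ≤ ∑_{k ≠ p, q} |h′(r_{pk})|`. [folklore] -/
theorem hLJ'_le_sum_abs_of_forceBalance {y : Fin N → EuclideanSpace ℝ (Fin 3)} (hy : Function.Injective y) {p q : Fin N} (hpq : p ≠ q)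
    (hF : ∀ e : EuclideanSpace ℝ (Fin 3), ∑ m ∈ Finset.univ.erase p,
      -(1 / 12) * (12 * (dist (y p) (y m))⁻¹ ^ 13 - 12 * (dist (y p) (y m))⁻¹ ^ 7) * (⟪y p - y m, e⟫_ℝ / dist (y p) (y m)) = 0) :
    hLJ' (dist (y p) (y q)) ≤ ∑ k ∈ (Finset.univ.erase p).erase q, |hLJ' (dist (y p) (y k))| := by
  have hq : q ∈ Finset.univ.erase p := Finset.mem_erase.2 ⟨hpq.symm, Finset.mem_univ _⟩
  set a : ℝ := dist (y p) (y q) with ha_def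
  have ha : 0 < a := dist_pos.2 (hy.ne hpq)
  set e : EuclideanSpace ℝ (Fin 3) := y q - y p with he_def
  have hen : ‖e‖ = a := by rw [he_def, ← dist_eq_norm, dist_comm]
  have hbal := hF e
  rw [← Finset.add_sum_erase _ _ hq] at hbal
  have hqin : ⟪y p - y q, e⟫_ℝ = -a ^ 2 := by
    rw [show y p - y q = -e by rw [he_def]; abel, inner_neg_left, real_inner_self_eq_norm_sq, hen]
  rw [hqin] at hbal
  -- Cauchy–Schwarz for the other terms
  have hT : ∀ k ∈ (Finset.univ.erase p).erase q,
      -(-(1 / 12) * (12 * (dist (y p) (y k))⁻¹ ^ 13 - 12 * (dist (y p) (y k))⁻¹ ^ 7) *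
          (⟪y p - y k, e⟫_ℝ / dist (y p) (y k))) ≤
        a / 12 * |12 * (dist (y p) (y k))⁻¹ ^ 13 - 12 * (dist (y p) (y k))⁻¹ ^ 7| := by
    intro k hk
    have hkp : k ≠ p := Finset.ne_of_mem_erase (Finset.mem_of_mem_erase hk)
    have hrk : 0 < dist (y p) (y k) := dist_pos.2 (hy.ne (Ne.symm hkp))
    have hcs : |⟪y p - y k, e⟫_ℝ / dist (y p) (y k)| ≤ a := by
      rw [abs_div, abs_of_pos hrk, div_le_iff₀ hrk]
      calc |⟪y p - y k, e⟫_ℝ| ≤ ‖y p - y k‖ * ‖e‖ := abs_real_inner_le_norm _ _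
        _ = a * dist (y p) (y k) := by rw [dist_eq_norm, hen, mul_comm]
    calc -(-(1 / 12) * (12 * (dist (y p) (y k))⁻¹ ^ 13 - 12 * (dist (y p) (y k))⁻¹ ^ 7) *
          (⟪y p - y k, e⟫_ℝ / dist (y p) (y k)))
        = 1 / 12 * ((12 * (dist (y p) (y k))⁻¹ ^ 13 - 12 * (dist (y p) (y k))⁻¹ ^ 7) *
          (⟪y p - y k, e⟫_ℝ / dist (y p) (y k))) := by ring
      _ ≤ 1 / 12 * |(12 * (dist (y p) (y k))⁻¹ ^ 13 - 12 * (dist (y p) (y k))⁻¹ ^ 7) *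
          (⟪y p - y k, e⟫_ℝ / dist (y p) (y k))| := by gcongr; exact le_abs_self _
      _ = 1 / 12 * (|12 * (dist (y p) (y k))⁻¹ ^ 13 - 12 * (dist (y p) (y k))⁻¹ ^ 7| *
          |⟪y p - y k, e⟫_ℝ / dist (y p) (y k)|) := by rw [abs_mul]
      _ ≤ 1 / 12 * (|12 * (dist (y p) (y k))⁻¹ ^ 13 - 12 * (dist (y p) (y k))⁻¹ ^ 7| * a) := by
          gcongr
      _ = a / 12 * |12 * (dist (y p) (y k))⁻¹ ^ 13 - 12 * (dist (y p) (y k))⁻¹ ^ 7| := by ring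
  have hsumT := Finset.sum_le_sum hT
  rw [Finset.sum_neg_distrib, ← Finset.mul_sum] at hsumT
  -- `h'(a) ≤ ∑ |h'(r_k)|`
  have hforce : 12 * a⁻¹ ^ 13 - 12 * a⁻¹ ^ 7 ≤
      ∑ k ∈ (Finset.univ.erase p).erase q,
        |12 * (dist (y p) (y k))⁻¹ ^ 13 - 12 * (dist (y p) (y k))⁻¹ ^ 7| := by
    have hq' : -(1 / 12) * (12 * a⁻¹ ^ 13 - 12 * a⁻¹ ^ 7) * (-a ^ 2 / a) =
        a / 12 * (12 * a⁻¹ ^ 13 - 12 * a⁻¹ ^ 7) := by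
      have hq'' : -a ^ 2 / a = -a := by rw [neg_div, pow_two, mul_self_div_self]
      rw [hq'']
      ring
    rw [hq'] at hbal
    have h12 : 0 < a / 12 := by positivity
    refine le_of_mul_le_mul_left ?_ h12
    linarith
  simpa only [hLJ'] using hforce

/-- **Capacity at `c = 7/20` (tree, certified):** over the other particles of a `7/10`-separated configuration,
`∑_{k ≠ p, q} kF(r_{pk}) ≤ (84/25)/(7/20)³ = 3840/49 ≈ 78.37` (`LjLaminarWindowsSketch.stub_forceCapacity stub_forceTheta stub_forceClubsuit`). -/
theorem sum_kF_le_of_sep {y : Fin N → EuclideanSpace ℝ (Fin 3)} (hsep : ∀ i j : Fin N, i ≠ j → (7 : ℝ) / 10 ≤ dist (y i) (y j)) (p q : Fin N) :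
    ∑ k ∈ (Finset.univ.erase p).erase q, kF (dist (y p) (y k)) ≤ 3840 / 49 := by
  have h2 := stub_forceCapacity stub_forceTheta stub_forceClubsuit N ((Finset.univ.erase p).erase q)
    (fun k => y k - y p) (7 / 20) (by norm_num) (by norm_num)
    (fun i hi => by
      have hip : i ≠ p := Finset.ne_of_mem_erase (Finset.mem_of_mem_erase hi)
      have h := hsep i p hip
      rw [dist_eq_norm] at h
      show 2 * (7 / 20 : ℝ) ≤ ‖y i - y p‖
      linarith)
    (fun i _ j _ hij => by
      show 2 * (7 / 20 : ℝ) ≤ dist (y i - y p) (y j - y p)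
      rw [dist_eq_norm, show y i - y p - (y j - y p) = y i - y j by abel, ← dist_eq_norm]
      linarith [hsep i j hij])
  have h2' : ∑ k ∈ (Finset.univ.erase p).erase q, kF (dist (y p) (y k)) =
      ∑ k ∈ (Finset.univ.erase p).erase q, kF ‖y k - y p‖ :=
    Finset.sum_congr rfl fun k _ => by rw [dist_comm, dist_eq_norm]
  rw [h2']
  exact h2.trans (by norm_num)

/-- **THE CONTACT FLOOR, sum form (PROVED, GS-free).** -/
theorem sum_hLJ_le_contactFloor {y : Fin N → EuclideanSpace ℝ (Fin 3)} (hy : Function.Injective y)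
    (hsep : ∀ i j : Fin N, i ≠ j → (7 : ℝ) / 10 ≤ dist (y i) (y j)) {p q : Fin N} (hpq : p ≠ q) (hF : ∀ e : EuclideanSpace ℝ (Fin 3), ∑ m ∈ Finset.univ.erase p,
      -(1 / 12) * (12 * (dist (y p) (y m))⁻¹ ^ 13 - 12 * (dist (y p) (y m))⁻¹ ^ 7) * (⟪y p - y m, e⟫_ℝ / dist (y p) (y m)) = 0) :
    ∑ k ∈ Finset.univ.erase p, hLJ (dist (y p) (y k)) ≤
      3840 / 49 + hLJ (dist (y p) (y q)) - 1 / 25 * hLJ' (dist (y p) (y q)) := by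
  have hq : q ∈ Finset.univ.erase p := Finset.mem_erase.2 ⟨hpq.symm, Finset.mem_univ _⟩
  rw [← Finset.add_sum_erase _ _ hq]
  have h1 := hLJ'_le_sum_abs_of_forceBalance hy hpq hF
  have h2 := sum_kF_le_of_sep hsep p q
  simp only [kF] at h2
  rw [Finset.sum_add_distrib, ← Finset.mul_sum] at h2
  linarith

/-- **THE CONTACT FLOOR (PROVED, GS-free):** at a force-balanced particle `p` of an injective `7/10`-separated configuration with a partner
`q` at distance `a`, `𝓔ᵖ ≥ −(1/12)·(3840/49 + h(a) − h′(a)/25)`. -/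
theorem contactFloor_le_siteEnergy {y : Fin N → EuclideanSpace ℝ (Fin 3)} (hy : Function.Injective y)
    (hsep : ∀ i j : Fin N, i ≠ j → (7 : ℝ) / 10 ≤ dist (y i) (y j)) {p q : Fin N} (hpq : p ≠ q) (hF : ∀ e : EuclideanSpace ℝ (Fin 3), ∑ m ∈ Finset.univ.erase p,
      -(1 / 12) * (12 * (dist (y p) (y m))⁻¹ ^ 13 - 12 * (dist (y p) (y m))⁻¹ ^ 7) * (⟪y p - y m, e⟫_ℝ / dist (y p) (y m)) = 0) :
    -(1 / 12) * (3840 / 49 + hLJ (dist (y p) (y q)) - 1 / 25 * hLJ' (dist (y p) (y q))) ≤ siteEnergy lennardJones y p := by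
  rw [siteEnergy_eq_sum_hLJ]
  have := sum_hLJ_le_contactFloor hy hsep hpq hF
  linarith

/-- Bernstein-positive polynomial form of RUNG 1: `(24/25 − 3840/49) a¹³ − 2a⁷ − (12/25)a⁶ + a + 12/25 ≥ 0` on `[7/10, 89/125]`. -/
theorem contactFloor_poly_rung1 {a : ℝ} (ha1 : 7 / 10 ≤ a) (ha2 : a ≤ 89 / 125) :
    0 ≤ (24 / 25 - 3840 / 49) * a ^ 13 - 2 * a ^ 7 - 12 / 25 * a ^ 6 + a + 12 / 25 := by
  have hu : 0 ≤ a - 7 / 10 := by linarith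
  have hw : 0 ≤ 89 / 125 - a := by linarith
  nlinarith [mul_nonneg (pow_nonneg hu 0) (pow_nonneg hw 13), mul_nonneg (pow_nonneg hu 1) (pow_nonneg hw 12),
    mul_nonneg (pow_nonneg hu 2) (pow_nonneg hw 11), mul_nonneg (pow_nonneg hu 3) (pow_nonneg hw 10),
    mul_nonneg (pow_nonneg hu 4) (pow_nonneg hw 9), mul_nonneg (pow_nonneg hu 5) (pow_nonneg hw 8),
    mul_nonneg (pow_nonneg hu 6) (pow_nonneg hw 7), mul_nonneg (pow_nonneg hu 7) (pow_nonneg hw 6),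
    mul_nonneg (pow_nonneg hu 8) (pow_nonneg hw 5), mul_nonneg (pow_nonneg hu 9) (pow_nonneg hw 4),
    mul_nonneg (pow_nonneg hu 10) (pow_nonneg hw 3), mul_nonneg (pow_nonneg hu 11) (pow_nonneg hw 2),
    mul_nonneg (pow_nonneg hu 12) (pow_nonneg hw 1), mul_nonneg (pow_nonneg hu 13) (pow_nonneg hw 0)]

/-- Bernstein-positive polynomial form of RUNG 2: `(42/5 − 3840/49) a¹³ − 2a⁷ − (12/25)a⁶ + a + 12/25 ≥ 0` on `[7/10, 179/250]`. -/
theorem contactFloor_poly_rung2 {a : ℝ} (ha1 : 7 / 10 ≤ a) (ha2 : a ≤ 179 / 250) :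
    0 ≤ (42 / 5 - 3840 / 49) * a ^ 13 - 2 * a ^ 7 - 12 / 25 * a ^ 6 + a + 12 / 25 := by
  have hu : 0 ≤ a - 7 / 10 := by linarith
  have hw : 0 ≤ 179 / 250 - a := by linarith
  nlinarith [mul_nonneg (pow_nonneg hu 0) (pow_nonneg hw 13), mul_nonneg (pow_nonneg hu 1) (pow_nonneg hw 12),
    mul_nonneg (pow_nonneg hu 2) (pow_nonneg hw 11), mul_nonneg (pow_nonneg hu 3) (pow_nonneg hw 10),
    mul_nonneg (pow_nonneg hu 4) (pow_nonneg hw 9), mul_nonneg (pow_nonneg hu 5) (pow_nonneg hw 8),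
    mul_nonneg (pow_nonneg hu 6) (pow_nonneg hw 7), mul_nonneg (pow_nonneg hu 7) (pow_nonneg hw 6),
    mul_nonneg (pow_nonneg hu 8) (pow_nonneg hw 5), mul_nonneg (pow_nonneg hu 9) (pow_nonneg hw 4),
    mul_nonneg (pow_nonneg hu 10) (pow_nonneg hw 3), mul_nonneg (pow_nonneg hu 11) (pow_nonneg hw 2),
    mul_nonneg (pow_nonneg hu 12) (pow_nonneg hw 1), mul_nonneg (pow_nonneg hu 13) (pow_nonneg hw 0)]

/-- RUNG 1 numeral: the contact floor is above `−(1/12)·(24/25) = −2/25 > −1/12` for contacts `a ≤ 0.712`. -/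
theorem contactFloor_le_rung1 {a : ℝ} (ha1 : 7 / 10 ≤ a) (ha2 : a ≤ 89 / 125) :
    3840 / 49 + hLJ a - 1 / 25 * hLJ' a ≤ 24 / 25 := by
  have ha : 0 < a := by linarith
  have key := contactFloor_poly_rung1 ha1 ha2
  have hexp : 24 / 25 - (3840 / 49 + hLJ a - 1 / 25 * hLJ' a) =
      ((24 / 25 - 3840 / 49) * a ^ 13 - 2 * a ^ 7 - 12 / 25 * a ^ 6 + a + 12 / 25) / a ^ 13 := by
    unfold hLJ hLJ'
    field_simp
    ring
  have hnn : 0 ≤ ((24 / 25 - 3840 / 49) * a ^ 13 - 2 * a ^ 7 - 12 / 25 * a ^ 6 + a + 12 / 25) / a ^ 13 :=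
    div_nonneg key (by positivity)
  linarith

/-- RUNG 2 numeral: the contact floor is above `−(1/12)·(42/5) = −7/10 > −0.711` for contacts `a ≤ 0.716`. -/
theorem contactFloor_le_rung2 {a : ℝ} (ha1 : 7 / 10 ≤ a) (ha2 : a ≤ 179 / 250) :
    3840 / 49 + hLJ a - 1 / 25 * hLJ' a ≤ 42 / 5 := by
  have ha : 0 < a := by linarith
  have key := contactFloor_poly_rung2 ha1 ha2
  have hexp : 42 / 5 - (3840 / 49 + hLJ a - 1 / 25 * hLJ' a) =
      ((42 / 5 - 3840 / 49) * a ^ 13 - 2 * a ^ 7 - 12 / 25 * a ^ 6 + a + 12 / 25) / a ^ 13 := by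
    unfold hLJ hLJ'
    field_simp
    ring
  have hnn : 0 ≤ ((42 / 5 - 3840 / 49) * a ^ 13 - 2 * a ^ 7 - 12 / 25 * a ^ 6 + a + 12 / 25) / a ^ 13 :=
    div_nonneg key (by positivity)
  linarith

/-- **RUNG OF THE CONTACT LAW (GS-free).** In an injective `7/10`-separated configuration, a particle `p` with zero net force and a
partner closer than `0.716` has site energy `≥ −7/10`. [folklore] -/
theorem siteEnergy_ge_of_contact_lt_0716 {y : Fin N → EuclideanSpace ℝ (Fin 3)} (hy : Function.Injective y)
    (hsep : ∀ i j : Fin N, i ≠ j → (7 : ℝ) / 10 ≤ dist (y i) (y j)) {p q : Fin N} (hpq : p ≠ q)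
    (hlt : dist (y p) (y q) < 179 / 250)
    (hF : ∀ e : EuclideanSpace ℝ (Fin 3), ∑ m ∈ Finset.univ.erase p,
      -(1 / 12) * (12 * (dist (y p) (y m))⁻¹ ^ 13 - 12 * (dist (y p) (y m))⁻¹ ^ 7) * (⟪y p - y m, e⟫_ℝ / dist (y p) (y m)) = 0) :
    -(7 / 10 : ℝ) ≤ siteEnergy lennardJones y p := by
  have h1 := contactFloor_le_siteEnergy hy hsep hpq hF
  have h2 := contactFloor_le_rung2 (hsep p q hpq) hlt.le
  linarith

/-- Same with a partner closer than `0.712`: site energy `≥ −2/25 > −1/12`. [folklore] -/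
theorem siteEnergy_ge_of_contact_lt_0712 {y : Fin N → EuclideanSpace ℝ (Fin 3)} (hy : Function.Injective y)
    (hsep : ∀ i j : Fin N, i ≠ j → (7 : ℝ) / 10 ≤ dist (y i) (y j)) {p q : Fin N} (hpq : p ≠ q)
    (hlt : dist (y p) (y q) < 89 / 125)
    (hF : ∀ e : EuclideanSpace ℝ (Fin 3), ∑ m ∈ Finset.univ.erase p,
      -(1 / 12) * (12 * (dist (y p) (y m))⁻¹ ^ 13 - 12 * (dist (y p) (y m))⁻¹ ^ 7) * (⟪y p - y m, e⟫_ℝ / dist (y p) (y m)) = 0) :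
    -(2 / 25 : ℝ) ≤ siteEnergy lennardJones y p := by
  have h1 := contactFloor_le_siteEnergy hy hsep hpq hF
  have h2 := contactFloor_le_rung1 (hsep p q hpq) hlt.le
  linarith

/-- **Every Lennard-Jones ground state is `0.712`-separated** (format of the tree's `stub_minDistance07`, which gives `7/10`).
Proof: the ground state is `7/10`-separated (tree) and force-balanced at `j` (`forceBalance_sum_deriv_eq_zero`); if `dist (x j) (x k) < 0.712`
the contact floor gives `𝓔ʲ ≥ −2/25`, contradicting `𝓔ʲ ≤ −1/12` (`forceBalance_one_le_sum_hLJ`, removal + insertion). [folklore] -/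
theorem lennardJones_groundState_dist_ge_0712 :
    ∀ (N : ℕ) (x : Fin N → EuclideanSpace ℝ (Fin 3)), IsGroundState lennardJones x →
      ∀ j k : Fin N, j ≠ k → (89 : ℝ) / 125 ≤ dist (x j) (x k) := by
  intro N x hx j k hjk
  by_contra hlt
  rw [not_le] at hlt
  have hsep : ∀ i l : Fin N, i ≠ l → (7 : ℝ) / 10 ≤ dist (x i) (x l) :=
    fun i l hil => lennardJones_groundState_dist_ge_seven_tenths hx hil
  have h1 := siteEnergy_ge_of_contact_lt_0712 hx.1 hsep hjk hlt (fun e => forceBalance_sum_deriv_eq_zero hx j e)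
  have h2 := forceBalance_one_le_sum_hLJ hx hjk
  rw [siteEnergy_eq_sum_hLJ] at h1
  linarith


/-! ### The CAPACITY DIAL (parametric floor): any sharper certified capacity `Λ` of the charged minus-energy moves both dials

For ANY bound `Λ` on `∑_{k ≠ p,q} kF(r_{pk})` (the tree certifies `Λ = 3840/49 ≈ 78.37`; the true supremum over `7/10`-separated families is
expected near `42`), the contact floor reads `𝓔ᵖ ≥ −(1/12)(Λ + h(a) − h′(a)/25)`.  Consequently `ρ`-separation of ALL Lennard-Jones ground
states follows from `Λ < G₁(ρ) := 1 − h(ρ) + h′(ρ)/25` and a floor above `−0.711 ≥ e⋆` (HOT at `ρ`) from `Λ < G₂(ρ) := 8.532 − h(ρ) + h′(ρ)/25`: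
`G₁/G₂ = 67.7/75.3 (0.72) · 55.8/63.4 (0.73) · 46.0/53.6 (0.74) · 37.9/45.5 (3/4) · 31.3/38.8 (0.76) · 21.2/28.8 (0.78) · 14.4/21.9 (0.80)`.
A certified spherical-code / shell count `Λ ≲ 50` would thus give `r_min ≥ 0.735` and HOT at `0.74` with no further Lean beyond the count. -/

/-- **Parametric contact floor (GS-free):** with any capacity bound `Λ` for the charged minus-energy over the other particles,
`𝓔ᵖ ≥ −(1/12)(Λ + h(a) − h′(a)/25)` at a zero-net-force particle `p` with a partner `q` at distance `a`. [folklore] -/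
theorem capFloor_le_siteEnergy {y : Fin N → EuclideanSpace ℝ (Fin 3)} (hy : Function.Injective y) {p q : Fin N} (hpq : p ≠ q)
    {Λ : ℝ} (hΛ : ∑ k ∈ (Finset.univ.erase p).erase q, kF (dist (y p) (y k)) ≤ Λ)
    (hF : ∀ e : EuclideanSpace ℝ (Fin 3), ∑ m ∈ Finset.univ.erase p,
      -(1 / 12) * (12 * (dist (y p) (y m))⁻¹ ^ 13 - 12 * (dist (y p) (y m))⁻¹ ^ 7) * (⟪y p - y m, e⟫_ℝ / dist (y p) (y m)) = 0) :
    -(1 / 12) * (Λ + hLJ (dist (y p) (y q)) - 1 / 25 * hLJ' (dist (y p) (y q))) ≤ siteEnergy lennardJones y p := by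
  have hq : q ∈ Finset.univ.erase p := Finset.mem_erase.2 ⟨hpq.symm, Finset.mem_univ _⟩
  have h1 := hLJ'_le_sum_abs_of_forceBalance hy hpq hF
  have h2 := hΛ
  simp only [kF] at h2
  rw [Finset.sum_add_distrib, ← Finset.mul_sum] at h2
  have h3 : ∑ k ∈ Finset.univ.erase p, hLJ (dist (y p) (y k)) ≤
      Λ + hLJ (dist (y p) (y q)) - 1 / 25 * hLJ' (dist (y p) (y q)) := by
    rw [← Finset.add_sum_erase _ _ hq]
    linarith
  rw [siteEnergy_eq_sum_hLJ]
  linarith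

/-- **The capacity dial, separation form:** in a Lennard-Jones ground state, if the charged capacity around `j` (excluding `k`) is `≤ Λ` and
`Λ + h(a) − h′(a)/25 < 1` at the distance `a = dist (x j) (x k)`, contradiction — so such a pair does not occur. [folklore] -/
theorem not_lt_one_of_cap_groundState {x : Fin N → EuclideanSpace ℝ (Fin 3)} (hx : IsGroundState lennardJones x) {j k : Fin N}
    (hjk : j ≠ k) {Λ : ℝ} (hΛ : ∑ m ∈ (Finset.univ.erase j).erase k, kF (dist (x j) (x m)) ≤ Λ) :
    ¬ (Λ + hLJ (dist (x j) (x k)) - 1 / 25 * hLJ' (dist (x j) (x k)) < 1) := by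
  intro hlt
  have h1 := capFloor_le_siteEnergy hx.1 hjk hΛ (fun e => forceBalance_sum_deriv_eq_zero hx j e)
  have h2 := forceBalance_one_le_sum_hLJ hx hjk
  rw [siteEnergy_eq_sum_hLJ] at h1
  linarith

end Summit.AtomisticToContinuum.Crystallization.Theorems.LoopTunnelDialContactFloor

end
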